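import Summits.CriticalPhenomena.PercolationContinuityZ3.Theorems.PercNearOneGluingNoHeavyLowerTailSunflowerBlowupSaturated
import HarnessLib

/-!
# `NoHeavyLowerTail` (crux stmt-CriticalPhenomena-4575), abstract sunflower cubic: A-SAFETY PULLS BACK ALONG HOMOMORPHISMS OUT OF
# MAXIMAL TRIANGLE-FREE GRAPHS

Support file (seat `prim-ineq-prove-1` gen 42; `--supports stmt-CriticalPhenomena-4575`).  No `sorry`, no named facts, standard axioms.
Memo: run/shared/lean/prim/prim-ineq-prove-1/FINDING-BLOWUP-prove1-g42.md §2b, §3.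

`…SunflowerBlowup` proved that A-safety of a graph core (`∀ p, Safe p (edgeCore Δ)`) passes to every pull-back `Δ.comap f`
(blow-ups of induced subgraphs), and `…SunflowerBlowupSaturated` that the conjecture `TriangleFreeSafe` reduces to MAXIMAL
triangle-free graphs (`K3Saturated`: every two distinct non-adjacent vertices have a common neighbour).  This file adds the
observation that makes the two fit together:

* `comap_eq_of_hom_of_k3Saturated` — a homomorphism `f : Γ →g Δ` from a maximal triangle-free graph `Γ` into a triangle-free
  graph `Δ` REFLECTS adjacency, i.e. `Δ.comap f = Γ` (if `f u ~ f v` but `u ≁ v`, a common neighbour `w` of `u, v` gives the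
  triangle `f u, f v, f w` in `Δ`).  So a maximal triangle-free graph is an induced subgraph of a blow-up of every triangle-free
  graph it maps to.
* `aSafe_of_hom_of_k3Saturated` — hence **A-safety pulls back along arbitrary homomorphisms out of maximal triangle-free graphs**:
  if `Δ` is triangle-free with an A-safe core and `Γ` is maximal triangle-free with `Γ →g Δ`, then the core of `Γ` is A-safe.
  (With (And) of `…SunflowerAndrasfai` this covers every maximal triangle-free graph homomorphic to an Andrásfai graph — by the
  theorems of Jin and Chen–Jin–Koh every maximal triangle-free graph with `χ ≤ 3` and minimum degree `> n/3`.)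
* `k3Saturated_iff_maximal` — sanity link with the literature's notion: for a triangle-free `Γ`, `K3Saturated Γ` iff no proper
  supergraph of `Γ` (on the same vertices) is triangle-free.
-/

namespace Summit.CriticalPhenomena.PercolationContinuityZ3.Theorems.SunflowerPartition

namespace SafeCalc

variable {V W : Type*}

/-- A homomorphism from a MAXIMAL triangle-free graph into a triangle-free graph reflects adjacency: the source is the
pull-back of the target.  (If `f u ~ f v` with `u ≁ v`, `u ≠ v`, a common neighbour `w` yields the triangle `{f u, f v, f w}`;
`u = v` is excluded by loop-freeness of `Δ`.) [this work] -/
theorem comap_eq_of_hom_of_k3Saturated {Γ : SimpleGraph V} {Δ : SimpleGraph W} (f : Γ →g Δ) (hΔ : Δ.CliqueFree 3)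
    (hΓ : K3Saturated Γ) : Δ.comap f = Γ := by
  ext u v
  simp only [SimpleGraph.comap_adj]
  refine ⟨fun h => ?_, fun h => f.map_adj h⟩
  classical
  by_contra hne
  have huv : u ≠ v := by
    rintro rfl
    exact h.ne rfl
  obtain ⟨w, huw, hvw⟩ := hΓ u v huv hne
  exact hΔ _ (SimpleGraph.is3Clique_triple_iff.2 ⟨h, f.map_adj huw, f.map_adj hvw⟩)

/-- **A-safety pulls back along homomorphisms out of maximal triangle-free graphs.**  If `Δ` is triangle-free with an A-safe
graph core and the maximal triangle-free graph `Γ` admits a homomorphism `Γ →g Δ`, then the graph core of `Γ` is A-safe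
(`Γ = Δ.comap f` by `comap_eq_of_hom_of_k3Saturated`, then `aSafe_edgeCore_comap`). [this work] -/
theorem aSafe_of_hom_of_k3Saturated [Fintype V] [Fintype W] {Γ : SimpleGraph V} {Δ : SimpleGraph W} (f : Γ →g Δ)
    (hΔ : Δ.CliqueFree 3) (hΓ : K3Saturated Γ) (h : ∀ q : W → unitInterval, Safe q (edgeCore Δ))
    (p : V → unitInterval) : Safe p (edgeCore Γ) := by
  rw [← comap_eq_of_hom_of_k3Saturated f hΔ hΓ]
  exact aSafe_edgeCore_comap f Δ h p

/-- For a triangle-free graph, `K3Saturated` (every two distinct non-adjacent vertices have a common neighbour) is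
MAXIMALITY among triangle-free graphs on the same vertex set: no strictly larger graph is triangle-free. [this work] -/
theorem k3Saturated_iff_maximal {Γ : SimpleGraph V} (hΓ : Γ.CliqueFree 3) :
    K3Saturated Γ ↔ ∀ Δ : SimpleGraph V, Γ < Δ → ¬ Δ.CliqueFree 3 := by
  classical
  constructor
  · intro hsat Δ hlt hΔ
    obtain ⟨hle, hne⟩ := lt_iff_le_and_ne.1 hlt
    -- an edge of `Δ` missing from `Γ`
    have : ∃ u v, Δ.Adj u v ∧ ¬ Γ.Adj u v := by
      by_contra hall
      simp only [not_exists, not_and, not_not] at hall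
      exact hne (le_antisymm hle fun u v h => hall u v h)
    obtain ⟨u, v, huv, hnuv⟩ := this
    obtain ⟨w, huw, hvw⟩ := hsat u v huv.ne hnuv
    exact hΔ _ (SimpleGraph.is3Clique_triple_iff.2 ⟨huv, hle huw, hle hvw⟩)
  · intro hmax u v hne hnuv
    -- add the edge `uv`; the new graph is strictly larger, hence has a triangle, which must use `uv`
    set Δ := Γ ⊔ SimpleGraph.edge u v with hΔdef
    have hlt : Γ < Δ := by
      refine lt_of_le_of_ne le_sup_left fun heq => hnuv ?_
      have : Δ.Adj u v := by
        rw [hΔdef, SimpleGraph.sup_adj, SimpleGraph.edge_adj]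
        exact Or.inr ⟨Or.inl ⟨rfl, rfl⟩, hne⟩
      rwa [← heq] at this
    have h3 := hmax Δ hlt
    simp only [SimpleGraph.CliqueFree, not_forall, not_not] at h3
    obtain ⟨s, hs⟩ := h3
    obtain ⟨a, b, c, hab, hac, hbc, -⟩ := SimpleGraph.is3Clique_iff.1 hs
    -- classify the three edges of the triangle: in `Γ`, or the new edge `uv`
    have key : ∀ x y, Δ.Adj x y → Γ.Adj x y ∨ ((x = u ∧ y = v) ∨ (x = v ∧ y = u)) := by
      intro x y h
      rw [hΔdef, SimpleGraph.sup_adj, SimpleGraph.edge_adj] at h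
      rcases h with h | ⟨h, -⟩
      · exact Or.inl h
      · exact Or.inr h
    -- two ordered copies of the new edge with the same first vertex have the same second vertex
    have pair : ∀ x y z, ((x = u ∧ y = v) ∨ (x = v ∧ y = u)) → ((x = u ∧ z = v) ∨ (x = v ∧ z = u)) → y = z := by
      rintro x y z (⟨hx, hy⟩ | ⟨hx, hy⟩) (⟨hx', hz⟩ | ⟨hx', hz⟩)
      · rw [hy, hz]
      · exact absurd (hx.symm.trans hx') hne
      · exact absurd (hx'.symm.trans hx) hne
      · rw [hy, hz]
    -- from a triangle `x y z` of `Δ` whose edge `xy` is the new edge, the third vertex is a common neighbour of `u, v` in `Γ`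
    have tri : ∀ x y z, Δ.Adj x z → Δ.Adj y z → ((x = u ∧ y = v) ∨ (x = v ∧ y = u)) →
        ∃ w, Γ.Adj u w ∧ Γ.Adj v w := by
      intro x y z hxz hyz hxy
      have hyx : (y = u ∧ x = v) ∨ (y = v ∧ x = u) :=
        hxy.elim (fun h => Or.inr ⟨h.2, h.1⟩) fun h => Or.inl ⟨h.2, h.1⟩
      have hxz' : Γ.Adj x z := by
        rcases key x z hxz with h | h
        · exact h
        · exact absurd (pair x y z hxy h) hyz.ne
      have hyz' : Γ.Adj y z := by
        rcases key y z hyz with h | h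
        · exact h
        · exact absurd (pair y x z hyx h) hxz.ne
      rcases hxy with ⟨hx, hy⟩ | ⟨hx, hy⟩
      · exact ⟨z, hx ▸ hxz', hy ▸ hyz'⟩
      · exact ⟨z, hy ▸ hyz', hx ▸ hxz'⟩
    rcases key a b hab with hab' | hnew
    · rcases key a c hac with hac' | hnew
      · rcases key b c hbc with hbc' | hnew
        · exact absurd (SimpleGraph.is3Clique_triple_iff.2 ⟨hab', hac', hbc'⟩) (hΓ _)
        · exact tri b c a hab.symm hac.symm hnew
      · exact tri a c b hab hbc.symm hnew
    · exact tri a b c hac hbc hnew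

end SafeCalc

end Summit.CriticalPhenomena.PercolationContinuityZ3.Theorems.SunflowerPartition
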